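import Summits.SmoothPoincare4.SmoothPoincare4.Theorems.CongruenceShadowsGriffithsHandlebodyExtensionCoverDefs
import Literature.Topology.FourManifolds.SlabFlow
import Literature.Topology.FourManifolds.DiffeotopyProofs
import Literature.Topology.FourManifolds.SchoenfliesPlane
import Literature.Topology.FourManifolds.EquidimensionalEmbedding
import Literature.Topology.FourManifolds.RadialExtension
import Literature.Topology.FourManifolds.CircleDiffeotopyProofs
import Literature.Topology.FourManifolds.DiffeotopyTransport
import Literature.Topology.FourManifolds.SmaleDiffDiscFamilies
import Mathlib.Analysis.SpecialFunctions.Log.Deriv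
import HarnessLib

/-!
# SmoothPoincare4 / CongruenceShadows — `GriffithsHandlebodyExtension` (item stmt-SmoothPoincare4-15190): the planar family (E3), A.1 — the conjugated family `S_t`

Support file (`--supports` stmt-SmoothPoincare4-15190) of the homothety-cover proof of the genus-one
clause (E) of Griffiths' handlebody extension theorem — *every self-diffeomorphism of the Heegaard torus
`∂V` of the round solid torus fixing the base point and acting trivially on `π₁(∂V)` extends to a
self-diffeomorphism of `V`* (hypothesis `hE` of
`Literature.Topology.FourManifolds.RoundSolidTorusModel.diffeoExtends_of_map_ker_eq_ker_of_forall_diffeoExtends`).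
See the module docstring of `…CoverDefs` for the whole line (E1–E6) and the notation
(`τ̂`, `δ_λ`, `ρ`, `χ`, `f`, `Δ^(c)`, `α`, `L`, `M`, `Ψ̂`, `ẽ_c`).

This part (E3-A, first half): the planar development `Planar.PI` (a copy of `PlanarInput`), the log scale `λ^t`, the
conjugated family `S_t = δ_{λ^t}⁻¹ ∘ τ ∘ δ_{λ^t}` (log-periodic: `S_{t+1} = S_t`), its velocity field `V` and the
flow equation `∂_t S_t = V_t ∘ S_t` off the origin.
-/

-- the registered namespace `Summit.SmoothPoincare4.SmoothPoincare4.Theorems` repeats a component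
set_option linter.dupNamespace false

noncomputable section

namespace Summit.SmoothPoincare4.SmoothPoincare4.Theorems

namespace HomothetyCover

open Set Function Metric Filter
open scoped Topology ContDiff

namespace Planar

open Set Function Metric Filter
open scoped Topology ContDiff Manifold
open Literature.Topology.FourManifolds

/-- `dim ℝ² = 1 + 1`, the instance under which Mathlib's manifold structure on the unit circle
`sphere (0 : E2) 1` (model `𝓡 1`) is found. -/
theorem factFinrankE2 : Fact (Module.finrank ℝ E2 = 1 + 1) := ⟨by simp [E2]⟩

attribute [local instance] factFinrankE2

/-- Planar input (copy of `HomothetyCover.PlanarInput`). -/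
structure PI (lam : ℝ) where
  /-- the lifted diffeomorphism, extended by `0 ↦ 0` -/
  τ : E2 → E2
  /-- its inverse -/
  τ' : E2 → E2
  /-- `τ 0 = 0` -/
  τ_zero : τ 0 = 0
  /-- `τ' 0 = 0` -/
  τ'_zero : τ' 0 = 0
  /-- `τ` is smooth off the origin -/
  contDiffAt_τ : ∀ y, y ≠ 0 → ContDiffAt ℝ ∞ τ y
  /-- `τ'` is smooth off the origin -/
  contDiffAt_τ' : ∀ y, y ≠ 0 → ContDiffAt ℝ ∞ τ' y
  /-- `τ' ∘ τ = id` -/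
  τ'_τ : ∀ y, τ' (τ y) = y
  /-- `τ ∘ τ' = id` -/
  τ_τ' : ∀ y, τ (τ' y) = y
  /-- equivariance under the deck homothety -/
  τ_smul : ∀ y, τ (lam • y) = lam • τ y

variable {lam : ℝ} (P : PI lam)

namespace PI

/-- `τ̂` has no zero off the origin (it has the inverse `τ̂'` and `τ̂' 0 = 0`). -/
theorem τ_ne_zero {y : E2} (hy : y ≠ 0) : P.τ y ≠ 0 := fun h => hy (by
  have := P.τ'_τ y; rw [h, P.τ'_zero] at this; exact this.symm)

/-- `τ̂'` has no zero off the origin. -/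
theorem τ'_ne_zero {y : E2} (hy : y ≠ 0) : P.τ' y ≠ 0 := fun h => hy (by
  have := P.τ_τ' y; rw [h, P.τ_zero] at this; exact this.symm)

/-- `τ̂` is injective (left inverse `τ̂'`). -/
theorem τ_injective : Injective P.τ := fun a b h => by
  have := congrArg P.τ' h; rwa [P.τ'_τ, P.τ'_τ] at this

/-! ### The log scale and the conjugated family `S_t = δ_{c(t)}⁻¹ τ δ_{c(t)}` -/

variable (lam) in
/-- `c(t) = λ^t = exp (t log λ)`. -/
def cexp (t : ℝ) : ℝ := Real.exp (t * Real.log lam)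

/-- `λ^t > 0`. -/
theorem cexp_pos (t : ℝ) : 0 < cexp lam t := Real.exp_pos _

/-- `λ^t ≠ 0`. -/
theorem cexp_ne_zero (t : ℝ) : cexp lam t ≠ 0 := (cexp_pos t).ne'

/-- `λ^0 = 1`. -/
theorem cexp_zero : cexp lam 0 = 1 := by simp [cexp]

/-- `λ^(t+1) = λ · λ^t`. -/
theorem cexp_add_one (hlam : 0 < lam) (t : ℝ) : cexp lam (t + 1) = lam * cexp lam t := by
  rw [cexp, cexp, add_mul, one_mul, Real.exp_add, Real.exp_log hlam, mul_comm]

/-- `t ↦ λ^t` is smooth. -/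
theorem contDiff_cexp : ContDiff ℝ ∞ (cexp lam) :=
  Real.contDiff_exp.comp (contDiff_id.mul contDiff_const)

/-- `d/dt λ^t = log λ · λ^t`. -/
theorem hasDerivAt_cexp (t : ℝ) : HasDerivAt (cexp lam) (Real.log lam * cexp lam t) t := by
  have h1 : HasDerivAt (fun y : ℝ => y * Real.log lam) (Real.log lam) t := by
    simpa using (hasDerivAt_id t).mul_const (Real.log lam)
  have h := h1.exp
  rw [show Real.log lam * cexp lam t = Real.exp (t * Real.log lam) * Real.log lam by
    rw [cexp, mul_comm]]
  exact h

/-- `S t u = c⁻¹ • τ (c • u)`, `c = λ^t`. -/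
def S (t : ℝ) (u : E2) : E2 := (cexp lam t)⁻¹ • P.τ (cexp lam t • u)

/-- Its inverse `S' t w = c⁻¹ • τ' (c • w)`. -/
def S' (t : ℝ) (w : E2) : E2 := (cexp lam t)⁻¹ • P.τ' (cexp lam t • w)

/-- `S'_t ∘ S_t = id`. -/
theorem S'_S (t : ℝ) (u : E2) : P.S' t (P.S t u) = u := by
  simp [S, S', smul_smul, mul_inv_cancel₀ (cexp_ne_zero t), P.τ'_τ, inv_mul_cancel₀ (cexp_ne_zero t)]

/-- `S_t ∘ S'_t = id`. -/
theorem S_S' (t : ℝ) (w : E2) : P.S t (P.S' t w) = w := by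
  simp [S, S', smul_smul, mul_inv_cancel₀ (cexp_ne_zero t), P.τ_τ', inv_mul_cancel₀ (cexp_ne_zero t)]

/-- `S_0 = τ`. -/
theorem S_zero (u : E2) : P.S 0 u = P.τ u := by simp [S, cexp_zero]

/-- `S_t` has no zero off the origin. -/
theorem S_ne_zero (t : ℝ) {u : E2} (hu : u ≠ 0) : P.S t u ≠ 0 :=
  smul_ne_zero (inv_ne_zero (cexp_ne_zero t)) (P.τ_ne_zero (smul_ne_zero (cexp_ne_zero t) hu))

/-- Periodicity `S (t + 1) = S t` (equivariance of `τ`). -/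
theorem S_add_one (hlam : 0 < lam) (t : ℝ) (u : E2) : P.S (t + 1) u = P.S t u := by
  rw [S, S, cexp_add_one hlam, mul_smul, P.τ_smul, smul_smul]
  congr 1
  field_simp

/-- `S` is smooth in `(t, u)` off `u = 0`. -/
theorem contDiffAt_S {t : ℝ} {u : E2} (hu : u ≠ 0) : ContDiffAt ℝ ∞ (uncurry P.S) (t, u) := by
  have hc : ContDiffAt ℝ ∞ (fun p : ℝ × E2 => cexp lam p.1) (t, u) :=
    contDiff_cexp.contDiffAt.comp _ contDiffAt_fst
  have hm : ContDiffAt ℝ ∞ (fun p : ℝ × E2 => cexp lam p.1 • p.2) (t, u) := hc.smul contDiffAt_snd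
  have hτ : ContDiffAt ℝ ∞ (fun p : ℝ × E2 => P.τ (cexp lam p.1 • p.2)) (t, u) :=
    (P.contDiffAt_τ (cexp lam t • u) (smul_ne_zero (cexp_ne_zero t) hu)).comp (t, u) hm
  exact (hc.inv (cexp_ne_zero t)).smul hτ

/-- `(t, w) ↦ S'_t w` is smooth off `w = 0`. -/
theorem contDiffAt_S' {t : ℝ} {w : E2} (hw : w ≠ 0) : ContDiffAt ℝ ∞ (uncurry P.S') (t, w) := by
  have hc : ContDiffAt ℝ ∞ (fun p : ℝ × E2 => cexp lam p.1) (t, w) :=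
    contDiff_cexp.contDiffAt.comp _ contDiffAt_fst
  have hm : ContDiffAt ℝ ∞ (fun p : ℝ × E2 => cexp lam p.1 • p.2) (t, w) := hc.smul contDiffAt_snd
  have hτ : ContDiffAt ℝ ∞ (fun p : ℝ × E2 => P.τ' (cexp lam p.1 • p.2)) (t, w) :=
    (P.contDiffAt_τ' (cexp lam t • w) (smul_ne_zero (cexp_ne_zero t) hw)).comp (t, w) hm
  exact (hc.inv (cexp_ne_zero t)).smul hτ

/-! ### The velocity field `V (t, w) = log λ • (Dτ (τ' (c w)) [c⁻¹ τ' (c w)] − w)` -/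

/-- The velocity of `t ↦ S t u` read at the point `w = S t u`. -/
def V (p : ℝ × E2) : E2 :=
  Real.log lam • ((fderiv ℝ P.τ (P.τ' (cexp lam p.1 • p.2))) ((cexp lam p.1)⁻¹ • P.τ' (cexp lam p.1 • p.2)) - p.2)

/-- The velocity field `V` of the conjugated family is smooth off the origin. -/
theorem contDiffAt_V {t : ℝ} {w : E2} (hw : w ≠ 0) : ContDiffAt ℝ ∞ P.V (t, w) := by
  have hc : ContDiffAt ℝ ∞ (fun p : ℝ × E2 => cexp lam p.1) (t, w) :=
    contDiff_cexp.contDiffAt.comp _ contDiffAt_fst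
  have hm : ContDiffAt ℝ ∞ (fun p : ℝ × E2 => cexp lam p.1 • p.2) (t, w) := hc.smul contDiffAt_snd
  have hmw : cexp lam t • w ≠ 0 := smul_ne_zero (cexp_ne_zero t) hw
  have hn : ContDiffAt ℝ ∞ (fun p : ℝ × E2 => P.τ' (cexp lam p.1 • p.2)) (t, w) :=
    (P.contDiffAt_τ' (cexp lam t • w) hmw).comp (t, w) hm
  have hnw : P.τ' (cexp lam t • w) ≠ 0 := P.τ'_ne_zero hmw
  have hD : ContDiffAt ℝ ∞ (fderiv ℝ P.τ) (P.τ' (cexp lam t • w)) :=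
    (P.contDiffAt_τ _ hnw).fderiv_right le_rfl
  have hDn : ContDiffAt ℝ ∞ (fun p : ℝ × E2 => fderiv ℝ P.τ (P.τ' (cexp lam p.1 • p.2))) (t, w) :=
    hD.comp (t, w) hn
  have hv : ContDiffAt ℝ ∞ (fun p : ℝ × E2 => (cexp lam p.1)⁻¹ • P.τ' (cexp lam p.1 • p.2)) (t, w) :=
    (hc.inv (cexp_ne_zero t)).smul hn
  have h := (hDn.clm_apply hv).sub contDiffAt_snd
  have h2 : ContDiffAt ℝ ∞ (fun p : ℝ × E2 => Real.log lam •
      ((fderiv ℝ P.τ (P.τ' (cexp lam p.1 • p.2))) ((cexp lam p.1)⁻¹ • P.τ' (cexp lam p.1 • p.2)) - p.2))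
      (t, w) := (contDiffAt_const (c := Real.log lam)).smul h
  exact h2

/-- The field along the track: `V (t, S t u) = log λ • (Dτ(c u) u − c⁻¹ τ (c u))`. -/
theorem V_track (t : ℝ) (u : E2) : P.V (t, P.S t u) =
    Real.log lam • ((fderiv ℝ P.τ (cexp lam t • u)) u - (cexp lam t)⁻¹ • P.τ (cexp lam t • u)) := by
  have hkey : P.τ' (cexp lam t • P.S t u) = cexp lam t • u := by
    rw [S, smul_smul, mul_inv_cancel₀ (cexp_ne_zero t), one_smul, P.τ'_τ]
  rw [V]
  simp only
  rw [hkey, smul_smul, inv_mul_cancel₀ (cexp_ne_zero t), one_smul, S]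

/-- **The field is the velocity**: `d/dt (S t u) = V (t, S t u)` for `u ≠ 0`. -/
theorem hasDerivAt_S {u : E2} (hu : u ≠ 0) (t : ℝ) :
    HasDerivAt (fun t => P.S t u) (P.V (t, P.S t u)) t := by
  set c := cexp lam t with hc
  set L := Real.log lam with hL
  have hcu : c • u ≠ 0 := smul_ne_zero (cexp_ne_zero t) hu
  -- derivative of `t ↦ c(t) • u`
  have h1 : HasDerivAt (fun t => cexp lam t • u) ((L * c) • u) t := (hasDerivAt_cexp t).smul_const u
  -- derivative of `t ↦ τ (c(t) • u)`
  have hτd : HasFDerivAt P.τ (fderiv ℝ P.τ (c • u)) (c • u) :=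
    ((P.contDiffAt_τ _ hcu).differentiableAt (by simp)).hasFDerivAt
  have h2 : HasDerivAt (fun t => P.τ (cexp lam t • u)) (fderiv ℝ P.τ (c • u) ((L * c) • u)) t :=
    hτd.comp_hasDerivAt t h1
  -- derivative of `t ↦ c(t)⁻¹`
  have h3 : HasDerivAt (fun t => (cexp lam t)⁻¹) (-(L * c) / c ^ 2) t := (hasDerivAt_cexp t).inv (cexp_ne_zero t)
  have h4 := h3.smul h2
  refine h4.congr_deriv ?_
  have hc0 : c ≠ 0 := cexp_ne_zero t
  rw [V_track, map_smul, smul_smul, smul_sub, smul_smul, ← hc]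
  rw [show c⁻¹ * (L * c) = L by field_simp, show -(L * c) / c ^ 2 = -(L * c⁻¹) by field_simp]
  rw [neg_smul, sub_eq_add_neg, add_comm]

end PI

end Planar

end HomothetyCover

end Summit.SmoothPoincare4.SmoothPoincare4.Theorems

end
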